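import Literature.NumberTheory.EllipticCurves.Kato2004.MemberHullZetaCoreInputs
import HarnessLib

/-!
# Kato 2004 (Astérisque 295) at Kato's member — the core package with the zeta-line index in PRINT
# (KUMMER) form: `MemberHullZetaKummerCoreInputs` and the fact `exists_memberHullZetaKummerCoreInputs`

Topic `NumberTheory/EllipticCurves`, sub-directory `Kato2004` (namespace = path).  Seat `bsd-potss-rkm`
(generation 22, cell `bsd-potss`; crux M = item stmt-BirchSwinnertonDyer-19196 `ReducibleKatoMember` of the
routes K9 / K8-t′).  DEFINITIONS ONLY: a hypothesis structure, two term-level conversions, ONE named fact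
(D-0014); nothing about BSD is proved; no instance beyond the structure-field projections, no notation.

WHY.  The sibling `MemberHullZetaCoreInputs` (p630270, seat rkm g21; planner TARGET R265) types clause (b′)
— Kato's local index `ν` of the zeta line at `p`, `[H¹(ℚ_p,T)/H¹_f(ℚ_p,T) : ℤ_p ȳ₀] = p^e` with
`e = ord_p(L(W,1)/Ω) + v_p(λ(0)) + ord_p #W(ℚ_p)[p^∞] − v_p(c_p)` (Prop. 14.16 (2) / Lemma 14.18; C.-H. Kim
§3.2.3 `exp*_ω(H¹(ℚ_p,T_pW)) = c_p · p^{−ord_p #W(ℚ_p)[p^∞]} · ℤ_p`; Thm. 12.5 (1) + Lemma 13.10 (1)) — in the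
PAIRING form `ZetaLineOrthIndexAt` (ONE direction, `≤ p^e`, the shape the crux-M ledger consumes), because
the finite-level local Tate duality turning the printed KUMMER form `ZetaLineIndexAt`
(`Kato2004/ZetaLineLocalIndex.lean`; cell `bsd-addord`'s currency `locModPk` / `kummerLocalConditionAt`)
into the pairing form was not in the tree.  It now is (Summits-side, seat rkm g22:
`Theorems/KatoDescentPotSupersingularKummerDescendedDuality.lean` and
`Theorems/KatoDescentPotSupersingularZetaLineKummerToOrth.lean` — `zetaLineOrthIndexAt_of_zetaLineIndexAt :
ZetaLineIndexAt W p y₀ e → ZetaLineOrthIndexAt W p y₀ e`, unconditional).  So the held input can be stated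
AT THE PRINTED STATEMENT:

* `MemberHullZetaKummerCoreInputs W p κ γ I 𝐲` := `MemberHullZetaCoreInputs` with the predicate
  `ZetaLineOrthIndexAt` of the clause `zetaLineIndex` replaced by `ZetaLineIndexAt` (same exponent `e`, same
  rationality display); every other field VERBATIM (same names, types, pins);
* `exists_memberHullZetaKummerCoreInputs` := the outer text of `exists_memberHullZetaCoreInputs` VERBATIM
  with the new structure;
* conversions `MemberHullZetaKummerCoreInputs.toMemberHullZetaCoreInputs` (given the pairing-form clause —
  a Summits-side theorem of the Kummer clause) and `MemberHullZetaCoreInputs.toMemberHullZetaKummerCoreInputs`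
  (given the Kummer clause).

The kernel theorems `MemberHullZetaKummerCoreInputs → MemberHullZetaCoreInputs` (no extra hypothesis) and
`exists_memberHullZetaKummerCoreInputs → exists_memberHullZetaCoreInputs` are Summits-side (seat rkm g22,
`Theorems/KatoDescentPotSupersingularMemberHullZetaCoreInputsOfKummer.lean`), because the bridge rests on the
Summits-side proof of Tate's local Euler–Poincaré characteristic formula.

PRINT-EXACT VS SAFE.  The Kummer clause asserts the EQUALITY of the index (both directions, every level
`p^k`); the pairing-form sibling asserts only the upper bound `≤ p^e` and is therefore implied by this fact
(kernel) and not conversely.  The exponent `e` is the printed one (Kato L. 14.18 `ν` with Kim's value of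
`exp*` on `H¹(ℚ_p, T_pW)` at an ADDITIVE `p`, where the Euler factor at `p` is `1`, and
`exp*(ȳ₀) = λ(0)·u·L(W,1)/Ω`, `u` a unit); `H¹_f(ℚ_p, T_pW)` = the Kummer image (Bloch–Kato Ex. 3.11) is built
into the finite-level phrasing of `ZetaLineIndexAt`.

HONEST SCOPE.  Nothing is booked: `exists_memberHullZetaKummerCoreInputs` is the transcription of Kato
Thm. 12.5 (1)–(3) / 12.6 / 13.10 (1) / 13.14 / (14.14.1)–(14.14.2) with (14.9.3) / Lemma 14.18 with Kim
§3.2.3 + Wuthrich L.14 AT KATO'S MEMBER (Kato's Euler system, explicit reciprocity — no `_holds` expected,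
size XL); net debt +1 named fact, which IMPLIES the sibling `exists_memberHullZetaCoreInputs` (kernel), so
the planner may key the held child of crux M to either and retire the other.  BSD is not advanced.  Referee
flag `Kato-12.6-13.10-14.18-14.14.2-member-reading-reducible`.

## References

* K. Kato, Astérisque 295 (2004): §8.2–8.3, (12.2.1), Thm. 12.4, Thm. 12.5, Thm. 12.6, Rem. 12.7, 13.9,
  Lemma 13.10 (1), 13.14, §14.1, (14.9.3), §14.14 (14.14.1)–(14.14.2), Prop. 14.16 (2) and its proof
  (pp. 244–245), §14.17, Lemma 14.18 (pp. 247–248) — store key `paper:doi-10-24033-ast-639`. [Kato2004Asterisque]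
* C.-H. Kim, Amer. J. Math. 148 (2026), §3.2.3 display before Thm. 3.7. [Kim2022StructureSelmer]
* S. Bloch, K. Kato (1990), Def. 3.10, Ex. 3.11. [BlochKato1990]
* C. Wuthrich, Doc. Math. 19 (2014), Lemma 12, Lemma 14. [Wuthrich2014]
* R. Greenberg, LNM 1716 (1999), Prop. 4.13 and §3. [GreenbergLNM1716]
* J. S. Milne, *ADT* (2006), I Cor. 2.3, Cor. 3.4, Thm. 4.10. [MilneADT2006]
* J. H. Silverman, *AEC* (2009), Prop. III.4.12 with Rem. III.4.13.2. [SilvermanAEC2009]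
* Tree: `MemberHullZetaCoreInputs.lean` (the sibling, whose imports and conventions this file shares),
  `ZetaLineLocalIndex.lean` (`ZetaLineIndexAt`, `ZetaLineOrthIndexAt`).
-/

noncomputable section

open scoped Classical NumberField TensorProduct
open Field IsDedekindDomain CongruenceSubgroup
open Literature.NumberTheory.GaloisRepresentations
open Literature.NumberTheory.EllipticCurves Literature.NumberTheory.EllipticCurves.ModularForms
open Literature.NumberTheory.EllipticCurves.Kato2004
open Literature.NumberTheory.EllipticCurves.Kato2004.EulerSystemValues Rat.HeightOneSpectrum
open Literature.NumberTheory.EllipticCurves.IwasawaAlgebra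

namespace Literature.NumberTheory.EllipticCurves.Kato2004

section Package

variable (W : WeierstrassCurve ℚ) [W.IsElliptic] (p : ℕ) [Fact p.Prime]
  [ContinuousSMul ℤ_[p] (W.tateModule p)] (κ : ZpExtension ℚ p) (γ : absoluteGaloisGroup ℚ)
  (I : IwasawaH1Data W p κ γ) (y : I.H)

/-- **Kato's rank-`0` descent inputs at his own lattice — the CORE package with the zeta-line index in
PRINT (KUMMER) FORM; hypothesis structure (a package of the printed statements; nothing asserted); the
sibling of `MemberHullZetaCoreInputs` whose clause (b′) is the index EQUALITY `ZetaLineIndexAt` instead of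
the one-directional pairing form `ZetaLineOrthIndexAt`.**  For an elliptic curve
`W/ℚ` (intended: Kato's member `W_K`, `T_pW ≅ V_{ℤ_p}(f)(1)`), a pinned Iwasawa cohomology
`I : IwasawaH1Data W p κ γ` and an element `y : I.H` (the `Λ`-adic class of a `ZetaBody` family): the
reflexive hull `j : I.H ↪ F` (13.14 / Wuthrich L.12), Kato's normalised zeta element `z = z_γ⁰ ∈ F`,
`z ≠ 0`, `F/Λz` torsion (Thm. 12.5 (1)(2)), the multiplier `lam ∈ Λ` of Lemma 13.10 (1) with
`j y = lam • z`, `lam(0) ≠ 0`; the abstract `H2 = 𝐇²(T)⁰`, finitely generated torsion ((12.2.1),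
Thm. 12.4 (1)); the module `A = H¹(ℤ[1/p],T)` PINNED to `integralH1 (tateRep W p) p (κ.layerSubgroup 0)`;
the maps `ι`, `π` of (14.14.1) with `π` surjective, exactness in the middle and the PIN
`toH1 ∘ ι ∘ mk = proj₀`; Thm. 12.5 (3) + Rem. 12.7 off `(p)`; `μ(𝐇²(T)⁰) = 0` (Wuthrich L.14, reducible
`W[p]`); AND the two printed inputs: (b′) the LOCAL INDEX OF THE ZETA LINE at `p` —
`L(W,1)/Ω(W)` is rational, `= q`, and for `e = ord_p q + v_p(λ(0)) + ord_p #W(ℚ_p)[p^∞] − v_p(c_p)` (a natural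
number) the bottom class `y₀ = proj₀ y` (moved to `H¹(⊤, T_pW)` by `layerZeroToTop`) satisfies
`ZetaLineIndexAt W p y₀ e` — «`loc_p(c·y₀) mod p^k` is a local Kummer class iff `p^k ∣ c·p^e`, for every
`k`, `c`» = `[H¹(ℚ_p,T)/H¹_f(ℚ_p,T) : ℤ_p ȳ₀] = p^e` (Prop. 14.16 (2) `ν` / Lemma 14.18 with Kim §3.2.3 and
Thm. 12.5 (1), Lemma 13.10 (1); `H¹_f(ℚ_p,T_pW)` = the Kummer image, Bloch–Kato Ex. 3.11); (c2′) the ORDER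
OF `𝐇²/X𝐇²` — `KatoH2CountAt W p #(coinvariants H2)` ((14.14.2) + (14.9.3)).  EXACTLY the field list of
`MemberHullZetaCoreInputs` with the predicate `ZetaLineOrthIndexAt` of the clause `zetaLineIndex` replaced by
`ZetaLineIndexAt`; same names, types, pins otherwise.
[cite: Kato2004Asterisque, Thm. 12.4 (1) (p. 221), Thm. 12.5 (1)–(3) (pp. 221–222), Thm. 12.6 and Rem. 12.7 (p. 222), Lemma 13.10 (1) (p. 230), 13.14 (p. 234), §14.14 (14.14.1)–(14.14.2) (p. 243), (14.9.3) (p. 240), Prop. 14.16 (2) (p. 244), Lemma 14.18 (pp. 247–248)]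
[cite: Kim2022StructureSelmer, §3.2.3 display before Thm. 3.7 (PDF p. 16)]
[cite: Wuthrich2014, Lemma 12 (p. 395), Lemma 14 (p. 396)] [cite: BlochKato1990, Def. 3.10 and Ex. 3.11]
[cite: MilneADT2006, Ch. I, Cor. 2.3 and Thm. 4.10] -/
structure MemberHullZetaKummerCoreInputs : Type 1 where
  /-- The reflexive hull `F = (𝐇¹_Γ)^{**}` (13.14 / Wuthrich L.12), abstract. -/
  F : Type
  [addCommGroupF : AddCommGroup F]
  [moduleF : _root_.Module (IwasawaAlgebra p) F]
  /-- `F` is finitely generated. -/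
  finite_F : Module.Finite (IwasawaAlgebra p) F
  /-- `F` is torsion free. -/
  torsionFree_F : NoZeroSMulDivisors (IwasawaAlgebra p) F
  /-- The inclusion `𝐇¹_Γ ↪ (𝐇¹_Γ)^{**}`. -/
  j : I.H →ₗ[IwasawaAlgebra p] F
  /-- `j` is injective. -/
  j_injective : Function.Injective j
  /-- The hull has finite (pseudo-null) cokernel. -/
  finite_coker : Finite (F ⧸ LinearMap.range j)
  /-- Kato's normalised zeta element `z_γ⁰` (`γ^+` a `ℤ_p`-basis of `T(−1)^+`), in the hull
  (Thm. 12.6 + 13.14). -/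
  z : F
  /-- `z_γ⁰ ≠ 0` (Thm. 12.5 (1) with 13.5 / 14.5 (2)). -/
  z_ne_zero : z ≠ 0
  /-- Thm. 12.5 (2) with 12.4 (2): `F/Λz` is torsion (rank one). -/
  isTorsion_quotient : Module.IsTorsion (IwasawaAlgebra p) (F ⧸ (IwasawaAlgebra p) ∙ z)
  /-- Lemma 13.10 (1): the multiplier `λ ∈ Λ` of the `(c,d,a(A))`-class. -/
  lam : IwasawaAlgebra p
  /-- Lemma 13.10 (1): `j y = λ • z_γ⁰`. -/
  j_y : j y = lam • z
  /-- `λ(0) ≠ 0` (the admissible `(c,d,a,A)` chosen with `γ_*^+ ≠ 0`). -/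
  lam_constantCoeff_ne_zero : PowerSeries.constantCoeff lam ≠ 0
  /-- `H2 = 𝐇²(T)⁰`, abstract. -/
  H2 : Type
  [addCommGroupH2 : AddCommGroup H2]
  [moduleH2 : _root_.Module (IwasawaAlgebra p) H2]
  /-- (12.2.1): `𝐇²` is finitely generated. -/
  finite_H2 : Module.Finite (IwasawaAlgebra p) H2
  /-- Thm. 12.4 (1): `𝐇²` is torsion. -/
  isTorsion_H2 : Module.IsTorsion (IwasawaAlgebra p) H2
  /-- `A = H¹(ℤ[1/p], T)` as a `Λ`-module (through the augmentation), pinned by `toH1`. -/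
  A : Type
  [addCommGroupA : AddCommGroup A]
  [moduleA : _root_.Module (IwasawaAlgebra p) A]
  /-- The PIN of `A`: an additive map to `H¹(ℚ, T_pW)` at the bottom layer `κ.layerSubgroup 0 = Γ_ℚ` … -/
  toH1 : A →+ H1 (tateRep W p) (κ.layerSubgroup 0)
  /-- … injective … -/
  toH1_injective : Function.Injective toH1
  /-- … with image exactly the integral classes `H¹(ℤ[1/p], T_pW)` (§8.2, Lemma 8.5) … -/
  mem_range_toH1_iff : ∀ x : H1 (tateRep W p) (κ.layerSubgroup 0),
    x ∈ Set.range toH1 ↔ x ∈ integralH1 (tateRep W p) p (κ.layerSubgroup 0)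
  /-- … and `Λ` acting on `A` through the augmentation `g ↦ g(0)` (so `X` acts as `0`). -/
  toH1_smul : ∀ (g : IwasawaAlgebra p) (a : A), toH1 (g • a) = PowerSeries.constantCoeff g • toH1 a
  /-- (14.14.1), first map `𝐇¹_Γ/X𝐇¹_Γ → H¹(ℤ[1/p],T)`. -/
  ι : coinvariants p I.H →ₗ[IwasawaAlgebra p] A
  /-- (14.14.1), second map `H¹(ℤ[1/p],T) → 𝐇²[X]`. -/
  π : A →ₗ[IwasawaAlgebra p] invariants p H2
  /-- (14.14.1): `π` surjective. -/
  π_surjective : Function.Surjective π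
  /-- (14.14.1): exact in the middle. -/
  exact_ι_π : Function.Exact ι π
  /-- The PIN of `ι`: `ι(x mod X) = proj₀ x` in `H¹(ℚ, T_pW)` (§13.8 / (14.14.1); `IwasawaH1Data.projZero`). -/
  toH1_ι : ∀ x : I.H, toH1 (ι (Submodule.Quotient.mk x)) = I.proj 0 x
  /-- Thm. 12.5 (3) with Rem. 12.7 (potentially good `p`: `𝐇²_loc = 0`), on the `Δ`-trivial component:
  `ℓ_𝔮(𝐇²) ≤ ℓ_𝔮(F/Λz_γ)` at every height-one `𝔮 ≠ (p)`. -/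
  divisibility_offP : ∀ 𝔮 : PrimeSpectrum (IwasawaAlgebra p), 𝔮.asIdeal.height = 1 →
    𝔮.asIdeal ≠ augIdealP p →
      Module.lengthAt (IwasawaAlgebra p) H2 𝔮 ≤
        Module.lengthAt (IwasawaAlgebra p) (F ⧸ (IwasawaAlgebra p) ∙ z) 𝔮
  /-- Wuthrich 2014 Lemma 14 + global duality (reducible `W[p]`, `p` odd): `μ(𝐇²(T)⁰) = 0`. -/
  mu_H2 : muInvariant p H2 = 0
  /-- (b′) THE LOCAL INDEX OF THE ZETA LINE AT `p`, PRINT (KUMMER) FORM (Prop. 14.16 (2) `ν`,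
  Lemma 14.18; Kim §3.2.3; Thm. 12.5 (1) with Lemma 13.10 (1)): `L(W,1)/Ω(W) = q ∈ ℚ`, the exponent
  `e = ord_p q + v_p(λ(0)) + ord_p #W(ℚ_p)[p^∞] − v_p(c_p)` is a natural number, and the bottom class
  `y₀ = proj₀ y` has local index EXACTLY `p^e` at `p`, in the Kummer form `ZetaLineIndexAt`: at every level
  `p^k` and for every `c ∈ ℤ`, `loc_p(c·y₀) mod p^k` is a local Kummer class iff `p^k ∣ c·p^e`
  (`[H¹(ℚ_p,T)/H¹_f(ℚ_p,T) : ℤ_p ȳ₀] = p^e` in print, `H¹_f` = the Kummer image). -/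
  zetaLineIndex : ∃ q : ℚ, W.entireLFunction 1 / (W.realPeriodRat : ℂ) = (q : ℂ) ∧
    ∃ e : ℕ, (e : ℤ) = padicValRat p q + ((PowerSeries.constantCoeff lam).valuation : ℤ) +
        (padicValNat p (Nat.card (AddCommGroup.primaryComponent
          (W.baseChange ((primePlace p).adicCompletion ℚ)).toAffine.Point p)) : ℤ) -
        (padicValNat p ((W.baseChange ((primePlace p).adicCompletion ℚ)).localTamagawaNumber
          ((primePlace p).adicCompletionIntegers ℚ)) : ℤ) ∧
      ZetaLineIndexAt W p (layerZeroToTop W p κ (I.proj 0 y)) e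
  /-- (c2′) THE ORDER OF `𝐇²/X𝐇²` ((14.14.2) `𝐇²/X𝐇² ≅ H²(ℤ[1/p],T)` + the count of `H²(ℤ[1/p],T)` through
  (14.9.3)): `#(𝐇²/X𝐇²) · #W(ℚ)[p^∞] = #Sel_str(ℚ, W[p^∞]) · #W(ℚ_p)[p^∞]`. -/
  katoH2Count : KatoH2CountAt W p (Nat.card (coinvariants p H2))

attribute [instance] MemberHullZetaKummerCoreInputs.addCommGroupF MemberHullZetaKummerCoreInputs.moduleF
  MemberHullZetaKummerCoreInputs.addCommGroupH2 MemberHullZetaKummerCoreInputs.moduleH2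
  MemberHullZetaKummerCoreInputs.addCommGroupA MemberHullZetaKummerCoreInputs.moduleA

end Package

/-! ## Term-level conversions with the pairing-form sibling (the bridge itself is Summits-side) -/

section Conversions

variable {W : WeierstrassCurve ℚ} [W.IsElliptic] {p : ℕ} [Fact p.Prime]
  [ContinuousSMul ℤ_[p] (W.tateModule p)] {κ : ZpExtension ℚ p} {γ : absoluteGaloisGroup ℚ}
  {I : IwasawaH1Data W p κ γ} {y : I.H}

/-- **From a Kummer-form core package to a `MemberHullZetaCoreInputs` package, GIVEN the pairing-form
clause** (b′)-`ZetaLineOrthIndexAt` — a theorem of the Kummer clause by local Tate duality, but Summits-side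
(`Theorems/KatoDescentPotSupersingularZetaLineKummerToOrth.lean`, `zetaLineOrthIndexAt_of_zetaLineIndexAt`);
here it is a hypothesis and the conversion is bookkeeping. [cite: Kato2004Asterisque, Lemma 14.18 (pp. 247–248)] -/
def MemberHullZetaKummerCoreInputs.toMemberHullZetaCoreInputs
    (Z : MemberHullZetaKummerCoreInputs W p κ γ I y)
    (hb : ∃ q : ℚ, W.entireLFunction 1 / (W.realPeriodRat : ℂ) = (q : ℂ) ∧
      ∃ e : ℕ, (e : ℤ) = padicValRat p q + ((PowerSeries.constantCoeff Z.lam).valuation : ℤ) +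
          (padicValNat p (Nat.card (AddCommGroup.primaryComponent
            (W.baseChange ((primePlace p).adicCompletion ℚ)).toAffine.Point p)) : ℤ) -
          (padicValNat p ((W.baseChange ((primePlace p).adicCompletion ℚ)).localTamagawaNumber
            ((primePlace p).adicCompletionIntegers ℚ)) : ℤ) ∧
        ZetaLineOrthIndexAt W p (layerZeroToTop W p κ (I.proj 0 y)) e) :
    MemberHullZetaCoreInputs W p κ γ I y where
  F := Z.F
  finite_F := Z.finite_F
  torsionFree_F := Z.torsionFree_F
  j := Z.j
  j_injective := Z.j_injective
  finite_coker := Z.finite_coker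
  z := Z.z
  z_ne_zero := Z.z_ne_zero
  isTorsion_quotient := Z.isTorsion_quotient
  lam := Z.lam
  j_y := Z.j_y
  lam_constantCoeff_ne_zero := Z.lam_constantCoeff_ne_zero
  H2 := Z.H2
  finite_H2 := Z.finite_H2
  isTorsion_H2 := Z.isTorsion_H2
  A := Z.A
  toH1 := Z.toH1
  toH1_injective := Z.toH1_injective
  mem_range_toH1_iff := Z.mem_range_toH1_iff
  toH1_smul := Z.toH1_smul
  ι := Z.ι
  π := Z.π
  π_surjective := Z.π_surjective
  exact_ι_π := Z.exact_ι_π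
  toH1_ι := Z.toH1_ι
  divisibility_offP := Z.divisibility_offP
  mu_H2 := Z.mu_H2
  zetaLineIndex := hb
  katoH2Count := Z.katoH2Count

/-- **From a `MemberHullZetaCoreInputs` package to a Kummer-form core package, GIVEN the Kummer-form clause**
(finer than the pairing form and not derivable from it). [cite: Kato2004Asterisque, Lemma 14.18 (pp. 247–248)] -/
def MemberHullZetaCoreInputs.toMemberHullZetaKummerCoreInputs (D : MemberHullZetaCoreInputs W p κ γ I y)
    (hb : ∃ q : ℚ, W.entireLFunction 1 / (W.realPeriodRat : ℂ) = (q : ℂ) ∧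
      ∃ e : ℕ, (e : ℤ) = padicValRat p q + ((PowerSeries.constantCoeff D.lam).valuation : ℤ) +
          (padicValNat p (Nat.card (AddCommGroup.primaryComponent
            (W.baseChange ((primePlace p).adicCompletion ℚ)).toAffine.Point p)) : ℤ) -
          (padicValNat p ((W.baseChange ((primePlace p).adicCompletion ℚ)).localTamagawaNumber
            ((primePlace p).adicCompletionIntegers ℚ)) : ℤ) ∧
        ZetaLineIndexAt W p (layerZeroToTop W p κ (I.proj 0 y)) e) :
    MemberHullZetaKummerCoreInputs W p κ γ I y where
  F := D.F
  finite_F := D.finite_F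
  torsionFree_F := D.torsionFree_F
  j := D.j
  j_injective := D.j_injective
  finite_coker := D.finite_coker
  z := D.z
  z_ne_zero := D.z_ne_zero
  isTorsion_quotient := D.isTorsion_quotient
  lam := D.lam
  j_y := D.j_y
  lam_constantCoeff_ne_zero := D.lam_constantCoeff_ne_zero
  H2 := D.H2
  finite_H2 := D.finite_H2
  isTorsion_H2 := D.isTorsion_H2
  A := D.A
  toH1 := D.toH1
  toH1_injective := D.toH1_injective
  mem_range_toH1_iff := D.mem_range_toH1_iff
  toH1_smul := D.toH1_smul
  ι := D.ι
  π := D.π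
  π_surjective := D.π_surjective
  exact_ι_π := D.exact_ι_π
  toH1_ι := D.toH1_ι
  divisibility_offP := D.divisibility_offP
  mu_H2 := D.mu_H2
  zetaLineIndex := hb
  katoH2Count := D.katoH2Count

end Conversions

/-! ## The named fact: the Kummer-form core package exists at Kato's member -/

/-- **Kato 2004, Thm. 12.5 (1)–(3), 12.6 + Lemma 13.10 (1) + 13.14, §14.14 (14.14.1)–(14.14.2) with the
count of `H²(ℤ[1/p],T)` through (14.9.3), Prop. 14.16 (2)'s local index `ν` / Lemma 14.18 (with C.-H.
Kim §3.2.3 at an additive `p`) IN PRINT (KUMMER) FORM, (12.2.1) and Thm. 12.4 (1) for `𝐇²`, and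
Wuthrich 2014 Lemma 14, AT KATO'S LATTICE `T = V_{ℤ_p}(f)(1)`: the CORE rank-`0` descent inputs, with the
zeta-line index as the printed EQUALITY, EXIST at Kato's member.**  For every
globally minimal elliptic curve `W/ℚ` and every prime `p ≠ 2` of ADDITIVE, POTENTIALLY GOOD
(`0 ≤ ord_p j(W)`) reduction with `W[p]` REDUCIBLE, `L(W,1) ≠ 0` and `Ш(W/ℚ)` finite, there is a GLOBALLY
MINIMAL curve `W_K/ℚ`, `ℚ`-isogenous to `W` (Kato's member: `T_pW_K ≅ V_{ℤ_p}(f)(1)`, §8.3 + *AEC*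
III.4.12 — displayed existentially), such that for the newform `f` of `W` and every family of complex
embeddings `ι` there are witnesses `(κ', Λ', c, d, a, A, z, x)` with `κ' ≠ 0`, `A ≥ 1`, `(c, 6pA) = 1`,
`(d, 6pN) = 1` satisfying `ZetaBody W_K p f ι κ' Λ' c d a A z x`, AND for every cyclotomic `ℤ_p`-tower `κ`
with topological generator `γ`, every `I : IwasawaH1Data W_K p κ γ` and THE element `𝐲 ∈ I.H` lifting
the corestricted `p`-power levels (`IwasawaH1Data.existsUnique_lift_of_zetaBody`), the structure
`MemberHullZetaKummerCoreInputs W_K p κ γ I 𝐲` is inhabited.  VERBATIM the outer text of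
`exists_memberHullZetaCoreInputs` with `MemberHullZetaKummerCoreInputs` for `MemberHullZetaCoreInputs`; the
sibling fact `exists_memberHullZetaCoreInputs` FOLLOWS from this one by the Summits-side kernel theorem
`zetaLineOrthIndexAt_of_zetaLineIndexAt` (local Tate duality for the descended Weil pairing, seat rkm g22),
hence so do `exists_memberHullZetaInputs` (modulo `poitouTate_selmerStructure_duality ℚ` + GZK) and the
crux-M closers.  A CONSTRUCTION fact (D-0014): in (b′) PRINT-EXACT (the index EQUALITY, not only `≤ p^e`),
elsewhere weaker than print (the identity of `F`, `𝐇²` is forgotten), never stronger; nothing asserted; no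
`_holds` expected (size XL: Kato's Euler system, explicit reciprocity).  Referee flag
`Kato-12.6-13.10-14.18-14.14.2-member-reading-reducible`.
[cite: Kato2004Asterisque, §8.3 (p. 181), (12.2.1) (p. 220), Thm. 12.4 (1) (p. 221), Thm. 12.5 (1)–(3) (pp. 221–222), Thm. 12.6 and Rem. 12.7 (p. 222), 13.9 and Lemma 13.10 (1) (pp. 229–230), 13.14 (p. 234), §14.1 (p. 235), (14.9.3) (p. 240), §14.14 (14.14.1)–(14.14.2) (p. 243), Prop. 14.16 (2) and its proof (pp. 244–245), Lemma 14.18 (pp. 247–248), (8.1.3) (p. 180), Ex. 13.3 (p. 225), Prop. 8.12 (p. 186), Thm. 9.7 (p. 189), Thm. 6.6 (1) (p. 163)]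
[cite: Kim2022StructureSelmer, §3.2.3 display before Thm. 3.7 (PDF p. 16)]
[cite: Wuthrich2014, §3.2 and Lemma 12 (pp. 394–395), Lemma 14 (p. 396)]
[cite: GreenbergLNM1716, Prop. 4.13 and the paragraph following its proof; §3 after Lemma 3.3]
[cite: MilneADT2006, Ch. I, Cor. 2.3 and Thm. 4.10] [cite: SilvermanAEC2009, Prop. III.4.12 with Rem. III.4.13.2] -/
def exists_memberHullZetaKummerCoreInputs : Prop :=
  ∀ (W : WeierstrassCurve ℚ) [W.IsElliptic] [W.IsGloballyMinimal] (p : ℕ) [Fact p.Prime]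
    (hp : p ≠ 2),
    ¬ W.HasGoodReductionAtPrime p → ¬ W.HasMultiplicativeReductionAtPrime p →
    0 ≤ padicValRat p W.j →
    ¬ W.HasIrreducibleModPGaloisRep p →
    W.entireLFunction 1 ≠ 0 → Finite W.sha →
    ∃ (W' : WeierstrassCurve ℚ) (_ : W'.IsElliptic) (_ : W'.IsGloballyMinimal),
      WeierstrassCurve.IsIsogenous W W' ∧
      ∀ [ContinuousSMul ℤ_[p] (W'.tateModule p)] [Module.Free ℤ_[p] (W'.tateModule p)]
        [Module.Finite ℤ_[p] (W'.tateModule p)],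
      ∀ {N : ℕ} [NeZero N] (f : CuspForm (Gamma0 N) 2), IsNewformOf W f →
      ∀ (ι : (m : ℕ) → (CyclotomicField m ℚ →+* ℂ)),
      ∃ (κ' : ℝ) (Λ' : ∀ (k : ℕ) (r : Finset (HeightOneSpectrum (𝓞 ℚ))),
          H1 (tateRep W' p) (cycSubgroup p k r) →ₗ[ℤ_[p]] ℚ_[p] ⊗[ℚ] CyclotomicField (cycLevel p k r) ℚ)
        (c d a : ℤ) (A : ℕ)
        (z : ∀ (k : ℕ) (r : (cyclotomicLevelsRat p (badPlaces c d A N)).Ideals),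
          H1 (tateRep W' p) ((cyclotomicLevelsRat p (badPlaces c d A N)).level k r.1))
        (x : ∀ (k : ℕ) (r : (cyclotomicLevelsRat p (badPlaces c d A N)).Ideals),
          CyclotomicField (cycLevel p k r.1) ℚ),
        κ' ≠ 0 ∧ 0 < A ∧ Int.gcd c (6 * p * A) = 1 ∧ Int.gcd d (6 * p * N) = 1 ∧
        ZetaBody W' p f ι κ' Λ' c d a A z x ∧
        ∀ (κ : ZpExtension ℚ p) (γ : absoluteGaloisGroup ℚ) (hκ : κ.IsCyclotomic),
          κ.IsTopGenerator γ →
          ∀ (I : IwasawaH1Data W' p κ γ) (y : I.H),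
            (∀ n : ℕ, I.proj n y = levelToLayer W' p hκ hp (badPlaces c d A N) n
              (z (n + 1) (cyclotomicLevelsRat p (badPlaces c d A N)).idealOne)) →
            Nonempty (MemberHullZetaKummerCoreInputs W' p κ γ I y)

end Literature.NumberTheory.EllipticCurves.Kato2004

end
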